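import Literature.Topology.FourManifolds.TautFoliationsTameGerm
import Literature.Topology.FourManifolds.TautFoliationsFenceAngleHeight
import Literature.Topology.FourManifolds.TautFoliationsConePositionRel
import HarnessLib

/-!
# The heights of the collar disc along the outer-collar grid edges are tame

Topic: coning a disc with a fence collar (NOTES §30 of the fact seat; Camacho–Lins Neto, Ch. VI
§3 Prop. 1 in class `C⁰` with the fence of the boundary loop kept on the collar). Let `G` be the
collar disc of a closed fence `Φ` (`TautFoliationsCollarDisc`): on the collar `dist(x, c₀) ≥ L/2`,
`G x = Φ (angleParam c₀ x) (levelOfParam τ₀ τ₁ (1 - dist(x, c₀)/L))`. Along every edge of every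
grid of the square `closedBall c₀ L` lying in the outer collar `T = {dist ≥ 7L/8}` and mapped
into the source of a flow box `e`, **the `e`-height of `G` is a tame function of the edge
parameter**: the level along the edge is an affine function of the distance to `c₀`, of piece
shape (`CollarLevels`), and the height is locally a homeomorphism germ of the level
(`FenceAngleHeight.exists_height_germ_descend`), whence tameness (`TameGerm`). Consequently the
relative cone position theorem applies: **there is a cone position of `G` whose skeleton equals
`G` on all the edges of the outer collar** (`exists_conePosition_collar`).

* `Grid.edge_eq_add_fst`, `Grid.edge_eq_add_snd`, `Grid.dist_edge_bigCentre_of_isBoundaryEdge`,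
  `dist_edge_le`, `dist_edge_of_isBoundaryEdge`, `isBoundaryEdge_of_one` (**proved**);
* `PieceShape.congr` (**proved**);
* `isTameOn_height_collarDisc` (**proved**), `exists_conePosition_collar` (**proved**).

All statements are [folklore].
-/

noncomputable section

open Set Filter Function Metric Real
open scoped Topology unitInterval

namespace Literature.Topology.FourManifolds

/-! ## Grid edges as translated segments -/

namespace SquareGrid.Grid

variable (g : Grid)

/-- Horizontal edges are translates of the parameter along the first axis. [folklore] -/
theorem edge_eq_add_fst (q : Fin g.n × Fin g.n) {k : Fin 4} (hk : k = 0 ∨ k = 1) (s : ℝ) :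
    g.edge q k s = g.edge q k 0 + ((s, 0) : ℝ × ℝ) := by
  rcases hk with rfl | rfl
  · simp
  · simp

/-- Vertical edges are translates of the parameter along the second axis. [folklore] -/
theorem edge_eq_add_snd (q : Fin g.n × Fin g.n) {k : Fin 4} (hk : k = 2 ∨ k = 3) (s : ℝ) :
    g.edge q k s = g.edge q k 0 + ((0, s) : ℝ × ℝ) := by
  rcases hk with rfl | rfl
  · simp
  · simp

/-- Every side index is horizontal or vertical. [folklore] -/
theorem fin_four_cases (k : Fin 4) : (k = 0 ∨ k = 1) ∨ (k = 2 ∨ k = 3) := by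
  fin_cases k <;> simp

/-- **Boundary edges lie on the boundary of the big square**: their points are at distance
`n ℓ` from the big centre. [folklore] -/
theorem dist_edge_bigCentre_of_isBoundaryEdge {q : Fin g.n × Fin g.n} {k : Fin 4} (hb : g.IsBoundaryEdge q k) {s : ℝ}
    (hs : s ∈ Icc 0 (2 * g.ℓ)) : dist (g.edge q k s) g.bigCentre = g.n * g.ℓ := by
  have hℓ := g.hℓ
  have h1 : ((q.1 : ℕ) : ℝ) + 1 ≤ g.n := by exact_mod_cast q.1.isLt
  have h2 : ((q.2 : ℕ) : ℝ) + 1 ≤ g.n := by exact_mod_cast q.2.isLt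
  have h1' : (0 : ℝ) ≤ (q.1 : ℕ) := Nat.cast_nonneg _
  have h2' : (0 : ℝ) ≤ (q.2 : ℕ) := Nat.cast_nonneg _
  have hnℓ : 0 ≤ (g.n : ℝ) * g.ℓ := by positivity
  -- the coordinate along the edge stays within `n ℓ` of the centre coordinate
  have hfst : |2 * (q.1 : ℕ) * g.ℓ + s - g.n * g.ℓ| ≤ g.n * g.ℓ := by
    rw [abs_le]; constructor <;> nlinarith [hs.1, hs.2]
  have hsnd : |2 * (q.2 : ℕ) * g.ℓ + s - g.n * g.ℓ| ≤ g.n * g.ℓ := by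
    rw [abs_le]; constructor <;> nlinarith [hs.1, hs.2]
  rcases hb with ⟨rfl, hq⟩ | ⟨rfl, hq⟩ | ⟨rfl, hq⟩ | ⟨rfl, hq⟩
  · have hq' : ((q.2 : ℕ) : ℝ) = 0 := by exact_mod_cast hq
    rw [edge_zero, bigCentre, Prod.dist_eq, Real.dist_eq, Real.dist_eq]
    simp only
    rw [show g.a.1 + 2 * (q.1 : ℕ) * g.ℓ + s - (g.a.1 + g.n * g.ℓ) = 2 * (q.1 : ℕ) * g.ℓ + s - g.n * g.ℓ by ring,
      show g.a.2 + 2 * (q.2 : ℕ) * g.ℓ - (g.a.2 + g.n * g.ℓ) = -(g.n * g.ℓ) by rw [hq']; ring, abs_neg, abs_of_nonneg hnℓ]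
    exact max_eq_right hfst
  · have hq' : ((q.2 : ℕ) : ℝ) + 1 = g.n := by exact_mod_cast hq
    rw [edge_one, bigCentre, Prod.dist_eq, Real.dist_eq, Real.dist_eq]
    simp only
    rw [show g.a.1 + 2 * (q.1 : ℕ) * g.ℓ + s - (g.a.1 + g.n * g.ℓ) = 2 * (q.1 : ℕ) * g.ℓ + s - g.n * g.ℓ by ring,
      show g.a.2 + (2 * (q.2 : ℕ) + 2) * g.ℓ - (g.a.2 + g.n * g.ℓ) = g.n * g.ℓ by rw [← hq']; ring, abs_of_nonneg hnℓ]
    exact max_eq_right hfst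
  · have hq' : ((q.1 : ℕ) : ℝ) = 0 := by exact_mod_cast hq
    rw [edge_two, bigCentre, Prod.dist_eq, Real.dist_eq, Real.dist_eq]
    simp only
    rw [show g.a.1 + 2 * (q.1 : ℕ) * g.ℓ - (g.a.1 + g.n * g.ℓ) = -(g.n * g.ℓ) by rw [hq']; ring,
      show g.a.2 + 2 * (q.2 : ℕ) * g.ℓ + s - (g.a.2 + g.n * g.ℓ) = 2 * (q.2 : ℕ) * g.ℓ + s - g.n * g.ℓ by ring, abs_neg,
      abs_of_nonneg hnℓ]
    exact max_eq_left hsnd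
  · have hq' : ((q.1 : ℕ) : ℝ) + 1 = g.n := by exact_mod_cast hq
    rw [edge_three, bigCentre, Prod.dist_eq, Real.dist_eq, Real.dist_eq]
    simp only
    rw [show g.a.1 + (2 * (q.1 : ℕ) + 2) * g.ℓ - (g.a.1 + g.n * g.ℓ) = g.n * g.ℓ by rw [← hq']; ring,
      show g.a.2 + 2 * (q.2 : ℕ) * g.ℓ + s - (g.a.2 + g.n * g.ℓ) = 2 * (q.2 : ℕ) * g.ℓ + s - g.n * g.ℓ by ring, abs_of_nonneg hnℓ]
    exact max_eq_left hsnd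

end SquareGrid.Grid

namespace Foliation

open SquareGrid SquareGrid.Grid SquarePolar CollarRadius TameFunction

variable {c₀ : ℝ × ℝ} {L : ℝ}

/-- The points of the edges of the grid of `closedBall c₀ L` are within `L` of `c₀`. [folklore] -/
theorem dist_edge_le (hL : 0 < L) {n : ℕ} (hn : 0 < n) (q : Fin n × Fin n) (k : Fin 4) {s : ℝ}
    (hs : s ∈ Icc 0 (2 * (grid c₀ hL hn).ℓ)) : dist ((grid c₀ hL hn).edge q k s) c₀ ≤ L := by
  have h := (grid c₀ hL hn).sq_subset_S q ((grid c₀ hL hn).edge_mem_sq q k hs)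
  rw [grid_S] at h
  exact mem_closedBall.1 h

/-- The big centre of the grid of `closedBall c₀ L` is `c₀` and `n ℓ = L`. [folklore] -/
theorem grid_bigCentre (hL : 0 < L) {n : ℕ} (hn : 0 < n) :
    (grid c₀ hL hn).bigCentre = c₀ ∧ ((grid c₀ hL hn).n : ℝ) * (grid c₀ hL hn).ℓ = L := by
  have hn' : (n : ℝ) ≠ 0 := Nat.cast_ne_zero.2 hn.ne'
  have h1 : ((grid c₀ hL hn).n : ℝ) * (grid c₀ hL hn).ℓ = L := by
    rw [grid_ℓ, grid_n]; field_simp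
  refine ⟨?_, h1⟩
  simp only [Grid.bigCentre, grid_a, h1]
  ext <;> simp

/-- Boundary edges of the grid of `closedBall c₀ L` are at distance `L` from `c₀`. [folklore] -/
theorem dist_edge_of_isBoundaryEdge (hL : 0 < L) {n : ℕ} (hn : 0 < n) {q : Fin n × Fin n} {k : Fin 4}
    (hb : (grid c₀ hL hn).IsBoundaryEdge q k) {s : ℝ} (hs : s ∈ Icc 0 (2 * (grid c₀ hL hn).ℓ)) :
    dist ((grid c₀ hL hn).edge q k s) c₀ = L := by
  obtain ⟨hc, hnl⟩ := grid_bigCentre (c₀ := c₀) hL hn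
  have h := (grid c₀ hL hn).dist_edge_bigCentre_of_isBoundaryEdge hb hs
  rwa [hc, hnl] at h

/-- For the grid with one square every edge is a boundary edge. [folklore] -/
theorem isBoundaryEdge_of_one (hL : 0 < L) (hn : 0 < 1) (q : Fin 1 × Fin 1) (k : Fin 4) :
    (grid c₀ hL hn).IsBoundaryEdge q k := by
  have hq1 : (q.1 : ℕ) = 0 := by simp
  have hq2 : (q.2 : ℕ) = 0 := by simp
  have hn1 : (grid c₀ hL hn).n = 1 := rfl
  unfold Grid.IsBoundaryEdge
  fin_cases k
  · exact Or.inl ⟨rfl, hq2⟩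
  · exact Or.inr (Or.inl ⟨rfl, by show (q.2 : ℕ) + 1 = 1; omega⟩)
  · exact Or.inr (Or.inr (Or.inl ⟨rfl, hq1⟩))
  · exact Or.inr (Or.inr (Or.inr ⟨rfl, by show (q.1 : ℕ) + 1 = 1; omega⟩))

/-- Piece shapes depend only on the values on the interval. [folklore] -/
theorem _root_.Literature.Topology.FourManifolds.CollarRadius.PieceShape.congr {f f' : ℝ → ℝ} {len : ℝ}
    (h : PieceShape f len) (heq : EqOn f f' (Icc 0 len)) : PieceShape f' len := by
  obtain ⟨u, hu, h⟩ := h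
  have hmono : ∀ {a b : ℝ}, Icc a b ⊆ Icc 0 len → (StrictMonoOn f (Icc a b) ∨ StrictAntiOn f (Icc a b)) →
      (StrictMonoOn f' (Icc a b) ∨ StrictAntiOn f' (Icc a b)) := by
    intro a b hsub hm
    rcases hm with hm | hm
    · exact Or.inl fun x hx y hy hxy ↦ by rw [← heq (hsub hx), ← heq (hsub hy)]; exact hm hx hy hxy
    · exact Or.inr fun x hx y hy hxy ↦ by rw [← heq (hsub hx), ← heq (hsub hy)]; exact hm hx hy hxy
  have h0 : (0 : ℝ) ∈ Icc 0 len := ⟨le_rfl, hu.1.trans hu.2⟩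
  have hl : len ∈ Icc 0 len := ⟨hu.1.trans hu.2, le_rfl⟩
  rcases h with ⟨h1, h2⟩ | ⟨h1, h2⟩
  · refine ⟨u, hu, Or.inl ⟨fun v hv ↦ ?_, hmono (Icc_subset_Icc_left hu.1) h2⟩⟩
    rw [← heq ⟨hv.1, hv.2.trans hu.2⟩, ← heq h0]; exact h1 v hv
  · refine ⟨u, hu, Or.inr ⟨hmono (Icc_subset_Icc_right hu.2) h1, fun v hv ↦ ?_⟩⟩
    rw [← heq ⟨hu.1.trans hv.1, hv.2⟩, ← heq hl]; exact h2 v hv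

variable {B : Type*} [NormedAddCommGroup B] [NormedSpace ℝ B] {M : Type*} [TopologicalSpace M] {F : Foliation B M}
variable {Γ : C(I, F.GermSpace)} {τ₀ ε : ℝ} {Φ : I → ℝ → M}

omit [NormedSpace ℝ B] in
/-- **The heights of the collar disc along the outer-collar grid edges are tame.** See the module
docstring. [folklore] -/
theorem isTameOn_height_collarDisc (hΦ : IsFenceOn F Γ τ₀ ε Φ univ) (hcl : ∀ τ ∈ Ioo (τ₀ - ε) (τ₀ + ε), Φ 1 τ = Φ 0 τ)
    {τ₁ : ℝ} (hτI : uIcc τ₀ τ₁ ⊆ Ioo (τ₀ - ε) (τ₀ + ε)) (hL : 0 < L) {G : ℝ × ℝ → M} (hGc : Continuous G)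
    (hG : ∀ x, L / 2 ≤ dist x c₀ → G x = Φ (angleParam c₀ x) (levelOfParam τ₀ τ₁ (1 - dist x c₀ / L)))
    {n : ℕ} (hn : 0 < n) {e : OpenPartialHomeomorph M (B × ℝ)} (he : e ∈ F.atlas) (q : Fin n × Fin n) (k : Fin 4)
    (hT : ∀ s ∈ Icc 0 (2 * (grid c₀ hL hn).ℓ), 7 * L / 8 ≤ dist ((grid c₀ hL hn).edge q k s) c₀)
    (hsrc : ∀ s ∈ Icc 0 (2 * (grid c₀ hL hn).ℓ), G ((grid c₀ hL hn).edge q k s) ∈ e.source) :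
    IsTameOn (fun s ↦ height e (G ((grid c₀ hL hn).edge q k s))) 0 (2 * (grid c₀ hL hn).ℓ) := by
  set len : ℝ := 2 * (grid c₀ hL hn).ℓ with hlen
  have hℓ : (grid c₀ hL hn).ℓ = L / n := grid_ℓ hL hn
  have hlen0 : 0 ≤ len := by have := (grid c₀ hL hn).hℓ; positivity
  -- the distance and the level along the edge
  set r : ℝ → ℝ := fun u ↦ dist ((grid c₀ hL hn).edge q k u) c₀ with hr
  set τf : ℝ → ℝ := fun u ↦ levelOfParam τ₀ τ₁ (1 - r u / L) with hτf
  have hrc : Continuous r := ((grid c₀ hL hn).continuous_edge q k).dist continuous_const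
  have hτc : Continuous τf := (continuous_levelOfParam τ₀ τ₁).comp (continuous_const.sub (hrc.div_const L))
  have hrle : ∀ u ∈ Icc 0 len, r u ≤ L := fun u hu ↦ dist_edge_le hL hn q k hu
  have hrge : ∀ u ∈ Icc 0 len, 7 * L / 8 ≤ r u := fun u hu ↦ hT u hu
  -- the shape of `r`
  have hrshape : PieceShape r len := by
    by_cases h1 : n = 1
    · subst h1
      have hb := isBoundaryEdge_of_one (c₀ := c₀) hL hn q k
      exact pieceShape_of_forall_eq hlen0 fun u hu ↦ by
        show dist ((grid c₀ hL hn).edge q k u) c₀ = dist ((grid c₀ hL hn).edge q k 0) c₀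
        rw [dist_edge_of_isBoundaryEdge hL hn hb hu, dist_edge_of_isBoundaryEdge hL hn hb ⟨le_rfl, hlen0⟩]
    · have hn2 : (2 : ℝ) ≤ n := by exact_mod_cast (show 2 ≤ n by omega)
      have hlenR : len ≤ 2 * (7 * L / 8) := by
        have h : L / n ≤ L / 2 := div_le_div_of_nonneg_left hL.le (by norm_num) hn2
        rw [hlen, hℓ]; linarith
      rcases fin_four_cases k with hk | hk
      · have heq : ∀ u, r u = dist ((grid c₀ hL hn).edge q k 0 + ((u, 0) : ℝ × ℝ)) c₀ := fun u ↦ by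
          show dist ((grid c₀ hL hn).edge q k u) c₀ = _; rw [(grid c₀ hL hn).edge_eq_add_fst q hk u]
        have h := dist_horizontal_pieceShape (c₀ := c₀) (x₀ := (grid c₀ hL hn).edge q k 0) hlen0
          (by positivity : (0 : ℝ) < 7 * L / 8) hlenR fun u hu ↦ by rw [← heq]; exact hrge u hu
        exact h.congr fun u _ ↦ (heq u).symm
      · have heq : ∀ u, r u = dist ((grid c₀ hL hn).edge q k 0 + ((0, u) : ℝ × ℝ)) c₀ := fun u ↦ by
          show dist ((grid c₀ hL hn).edge q k u) c₀ = _; rw [(grid c₀ hL hn).edge_eq_add_snd q hk u]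
        have h := dist_vertical_pieceShape (c₀ := c₀) (x₀ := (grid c₀ hL hn).edge q k 0) hlen0
          (by positivity : (0 : ℝ) < 7 * L / 8) hlenR fun u hu ↦ by rw [← heq]; exact hrge u hu
        exact h.congr fun u _ ↦ (heq u).symm
  -- the shape of the level: affine in `r` on the outer collar
  have hτshape : PieceShape τf len := by
    have haff : ∀ u ∈ Icc 0 len, τf u = (τ₀ + (τ₁ - τ₀) * 4) + (-(4 * (τ₁ - τ₀) / L)) * r u := by
      intro u hu
      have hs0 : 0 ≤ 1 - r u / L := by rw [sub_nonneg, div_le_one hL]; exact hrle u hu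
      have hs1 : 1 - r u / L ≤ 1 / 4 := by
        have := hrge u hu
        rw [sub_le_comm, le_div_iff₀ hL]; linarith
      show levelOfParam τ₀ τ₁ (1 - r u / L) = _
      rw [levelOfParam_of_le hs0 hs1]
      field_simp
      ring
    by_cases h01 : τ₁ = τ₀
    · refine pieceShape_of_forall_eq hlen0 fun u hu ↦ ?_
      rw [haff u hu, haff 0 ⟨le_rfl, hlen0⟩, h01]; ring
    · have hB : -(4 * (τ₁ - τ₀) / L) ≠ 0 :=
        neg_ne_zero.2 (div_ne_zero (mul_ne_zero four_ne_zero (sub_ne_zero.2 h01)) hL.ne')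
      exact (hrshape.affine_comp (τ₀ + (τ₁ - τ₀) * 4) hB).congr fun u hu ↦ (haff u hu).symm
  -- the heights as heights of the descended fence
  have hform : ∀ u ∈ Icc 0 len, height e (G ((grid c₀ hL hn).edge q k u)) =
      height e (IsFenceOn.descendFence Φ (ang c₀ ((grid c₀ hL hn).edge q k u), τf u)) := by
    intro u hu
    rw [hG _ (by linarith [hrge u hu]), IsFenceOn.apply_angleParam_eq_descendFence (Φ := Φ)]
  -- admissible levels
  have hτadm : ∀ u, τf u ∈ Ioo (τ₀ - ε) (τ₀ + ε) := fun u ↦ hτI (levelOfParam_mem τ₀ τ₁ _)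
  -- continuity of the heights
  have hfc : ContinuousOn (fun s ↦ height e (G ((grid c₀ hL hn).edge q k s))) (Icc 0 len) := by
    have h1 : Continuous fun s ↦ G ((grid c₀ hL hn).edge q k s) := hGc.comp ((grid c₀ hL hn).continuous_edge q k)
    have h2 : ContinuousOn (fun z ↦ height e z) e.source := fun z hz ↦
      (continuous_snd.continuousAt.comp (e.continuousAt hz)).continuousWithinAt
    exact h2.comp h1.continuousOn fun s hs ↦ hsrc s hs
  refine isTameOn_of_local_germ hfc hτc.continuousOn hτshape fun u₀ hu₀ ↦ ?_
  -- the local height germ at `u₀`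
  have hne : (grid c₀ hL hn).edge q k u₀ ≠ c₀ := fun h ↦ by
    have := hrge u₀ hu₀
    rw [show r u₀ = dist ((grid c₀ hL hn).edge q k u₀) c₀ from rfl, h, dist_self] at this
    linarith
  have hsrc₀ : IsFenceOn.descendFence Φ (ang c₀ ((grid c₀ hL hn).edge q k u₀), τf u₀) ∈ e.source := by
    rw [← IsFenceOn.apply_angleParam_eq_descendFence (Φ := Φ), ← hG _ (by linarith [hrge u₀ hu₀])]
    exact hsrc u₀ hu₀
  obtain ⟨χ, hχ, hev⟩ := hΦ.exists_height_germ_descend hcl he (hτadm u₀) hsrc₀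
  refine ⟨χ, hχ, ?_⟩
  have hca : ContinuousAt (fun u ↦ (ang c₀ ((grid c₀ hL hn).edge q k u), τf u)) u₀ :=
    ((continuousAt_ang hne).comp ((grid c₀ hL hn).continuous_edge q k).continuousAt).prodMk hτc.continuousAt
  have h1 : ∀ᶠ u in 𝓝 u₀, height e (IsFenceOn.descendFence Φ (ang c₀ ((grid c₀ hL hn).edge q k u), τf u)) = χ (τf u) :=
    hca.eventually hev
  have h2 : ∀ᶠ u in 𝓝[Icc 0 len] u₀, u ∈ Icc 0 len := self_mem_nhdsWithin
  filter_upwards [nhdsWithin_le_nhds h1, h2] with u hu huI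
  rw [hform u huI, hu]

/-- **A cone position of the collar disc keeping the disc map on the outer-collar edges.**
[folklore] -/
theorem exists_conePosition_collar [ProperSpace B] [T2Space M] (ho : F.IsTransverselyOriented)
    (hΦ : IsFenceOn F Γ τ₀ ε Φ univ) (hcl : ∀ τ ∈ Ioo (τ₀ - ε) (τ₀ + ε), Φ 1 τ = Φ 0 τ)
    {τ₁ : ℝ} (hτI : uIcc τ₀ τ₁ ⊆ Ioo (τ₀ - ε) (τ₀ + ε)) (hL : 0 < L) {G : ℝ × ℝ → M} (hGc : Continuous G)
    (hG : ∀ x, L / 2 ≤ dist x c₀ → G x = Φ (angleParam c₀ x) (levelOfParam τ₀ τ₁ (1 - dist x c₀ / L))) :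
    ∃ P : ConePosition F G c₀ hL, ∀ q k, P.gr.edge q k '' Icc 0 (2 * P.gr.ℓ) ⊆ {x | 7 * L / 8 ≤ dist x c₀} →
      ∀ s ∈ Icc 0 (2 * P.gr.ℓ), P.skel (P.gr.edge q k s) = G (P.gr.edge q k s) := by
  refine IsTransverselyOriented.nonempty_conePosition_rel F ho hL hGc.continuousOn {x | 7 * L / 8 ≤ dist x c₀} ?_ ?_
  · -- boundary edges lie on the big sphere: distance `L`
    intro n hn e he q k hb hsrc
    refine isTameOn_height_collarDisc hΦ hcl hτI hL hGc hG hn he q k (fun s hs ↦ ?_) hsrc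
    rw [dist_edge_of_isBoundaryEdge hL hn hb hs]
    linarith
  · intro n hn e he q k hT hsrc
    exact isTameOn_height_collarDisc hΦ hcl hτI hL hGc hG hn he q k (fun s hs ↦ hT (mem_image_of_mem _ hs)) hsrc

end Foliation

end Literature.Topology.FourManifolds
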